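import Literature.NumberTheory.EllipticCurves.IwasawaAlgebraSpecializationCountProofs
import HarnessLib

/-!
# The FINITE Eisenstein quotients `A_{m,k} = Λ/(q_m, p^k)` of the Iwasawa algebra: `T` is nilpotent,
# `1 + T` has `p`-power order, and `ω_n = (1+T)^{p^n} − 1 ∈ (q_m, p^k)` for all large `n` (proofs file)

Topic `NumberTheory/EllipticCurves`. THEOREMS ONLY (no definition, no named fact, no instance, no `sorry`),
in the vocabulary of the tree (`IwasawaAlgebra p = ℤ_p⟦T⟧`, `q_m = T^m + p` spelled
`PowerSeries.X ^ m + PowerSeries.C (p : ℤ_[p])`, the ideal `(q_m, p^k)` spelled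
`Ideal.span {q_m} ⊔ Ideal.span {PowerSeries.C ((p : ℤ_[p]) ^ k)}` as in
`IwasawaAlgebra.card_quotient_span_qm_sup_span_C_pow`).

WHAT. Let `q_m = T^m + p` (`m ≥ 1`) and `A_{m,k} := Λ/(q_m, p^k)` — the finite coefficient ring of the
`p^k`-torsion of Howard's specialisation `T_𝔮 = 𝐓 ⊗_Λ S_𝔮`, `S_𝔮 = Λ/q_m`, at the Eisenstein prime
`𝔮 = (T^m + p)`: `T_𝔮/p^k T_𝔮 = E[p^k] ⊗ A_{m,k}(ψ)` [Howard 2004, §2.2 and proof of Thm. 2.2.10, "taking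
`𝔮 = T^m + p`"]. This file proves the elementary ring-theoretic facts about `A_{m,k}` that the definition of
these twisted modules and their control theory consume:

* §1 (pure algebra) `exists_one_add_pow_prime_pow_eq_one`: in a FINITE commutative ring in which `p` is
  nilpotent, `1 + x` has `p`-power order for every nilpotent `x` (`∃ a, (1 + x)^{p^a} = 1`); with the
  auxiliary binomial identity `exists_one_add_pow_eq` (`(1+y)^n = 1 + n y + y² c`).
* §2 `X_pow_mul_mem_span_qm_sup_span_C_pow` (`T^{mk} ∈ (q_m, p^k)`), `isNilpotent_mk_X`,
  `natCast_pow_eq_zero_quotient` (`p^k = 0` in `A_{m,k}`), `isNilpotent_natCast_quotient`,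
  `finite_quotient_span_qm_sup_span_C_pow` (`#A_{m,k} = p^{km}`, tree).
* §3 `exists_onePlusX_pow_prime_pow_sub_one_mem` (**`∃ J, ω_J ∈ (q_m, p^k)`**),
  `onePlusX_pow_prime_pow_sub_one_dvd_of_le` (`ω_J ∣ ω_n` for `J ≤ n`),
  `exists_forall_onePlusX_pow_prime_pow_sub_one_mem` (`∃ J, ∀ n ≥ J, ω_n ∈ (q_m, p^k)`),
  `span_omega_sup_span_C_pow_le` (`(ω_n, p^k) ≤ (q_m, p^k)`: `A_{m,k}` is a quotient of the level-`n`
  coefficient ring `Λ/(ω_n, p^k) = ℤ/p^k[Gal(K_n/K)]`), and the unit form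
  `exists_mk_onePlusX_pow_prime_pow_eq_one` (`∃ J, (1+T)^{p^J} = 1` in `A_{m,k}`).

WHY (use). (i) The twisted module `E[p^k] ⊗ A_{m,k}(ψ)`, `ψ : γ ↦ 1 + T`, is defined on the pattern of the
tree's `ZpExtension.galoisTwist` (exponent `κ(σ) mod p^J`), which needs an exponent `J` with
`(1+T)^{p^J} = 1` on the module — §3 supplies it. (ii) In the control theorem at `𝔮 = q_m` [Howard 2004,
Lemma 2.2.7 / Prop. 2.2.8] the compact side `𝔖 = lim H¹(K_n, E[p^k]) → H¹(K, T_𝔮/p^k)` passes through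
Shapiro's lemma `H¹(K_n, E[p^k]) = H¹(K, E[p^k] ⊗ Λ/(ω_n, p^k))`, `ω_n = (1+T)^{p^n} − 1`, followed by the
change of coefficients `Λ/(ω_n, p^k) ↠ A_{m,k}` — which exists exactly when `ω_n ∈ (q_m, p^k)`, §3.
Cell `pub/bsd-print-x9`, D1 road of the shared μ-residual of rows 9/10 (memo PORT-ALGEBRA-LAYER §5 step 1);
pure commutative algebra, nothing about Galois cohomology is asserted here. BSD is not proved by any of this.

References: [Howard2004HeegnerKolyvagin] B. Howard, *The Heegner point Kolyvagin system*, Compositio Math. 140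
(2004), §2.2 (the modules `T_𝔮`), Lemma 2.2.7, Prop. 2.2.8, proof of Thm. 2.2.10; [Washington1997]
L. Washington, *Introduction to Cyclotomic Fields*, §7.1 (distinguished polynomials), §13.2 (Lemma 13.7:
`ω_n`, the group rings `ℤ_p[Gal(K_n/K)] = Λ/(ω_n)`); [MazurRubin2004KolyvaginSystems] B. Mazur, K. Rubin,
Mem. AMS 799 (2004), §5.3 (specialisations of `Λ`-adic Kolyvagin systems at height-one primes).
-/

noncomputable section

open scoped Classical

universe u

namespace Literature.NumberTheory.EllipticCurves.IwasawaAlgebra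

/-! ## §1 Pure algebra: `1 + x` has `p`-power order for `x` nilpotent, in a finite ring where `p` is nilpotent -/

section PureAlgebra

variable {A : Type u} [CommRing A]

/-- Binomial identity to second order: `(1 + y)^n = 1 + n·y + y²·c` for some `c`.
[cite: Washington1997, §13.2 (Lemma 13.7, binomial expansions of (1+T)^{p^n})] -/
theorem exists_one_add_pow_eq (y : A) (n : ℕ) : ∃ c : A, (1 + y) ^ n = 1 + (n : A) * y + y ^ 2 * c := by
  induction n with
  | zero => exact ⟨0, by simp⟩
  | succ n ih =>
    obtain ⟨c, hc⟩ := ih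
    refine ⟨c + (n : A) + y * c, ?_⟩
    rw [pow_succ, hc]
    push_cast
    ring

/-- **`1 + x` has `p`-power order.** In a finite commutative ring `A` in which the prime `p` is nilpotent
(e.g. `p^k · 1 = 0`), for every nilpotent `x` there is an `a` with `(1 + x)^{p^a} = 1`. Proof: `u = 1 + x` is
a unit of finite order `p^a · n'` with `p ∤ n'`; `v = u^{p^a} = 1 + y` with `y ∈ xA` nilpotent and
`v^{n'} = 1`, i.e. `y · (n' + y c) = 0`; `n'` is a unit of `A` (coprime to the nilpotent `p`) and so is
`n' + y c`, whence `y = 0`. (The group `1 + 𝔪` of a finite local ring of residue characteristic `p` is a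
`p`-group.) [cite: Washington1997, §13.2 (Lemma 13.7)] [cite: Howard2004HeegnerKolyvagin, proof of Thm. 2.2.10 (𝔮 = T^m + p)] -/
theorem exists_one_add_pow_prime_pow_eq_one [Finite A] {p : ℕ} (hp : p.Prime)
    (hpA : IsNilpotent (p : A)) {x : A} (hx : IsNilpotent x) : ∃ a : ℕ, (1 + x) ^ (p ^ a) = 1 := by
  obtain ⟨u, hu⟩ := hx.isUnit_one_add
  have hord : 0 < orderOf u := (isOfFinOrder_of_finite u).orderOf_pos
  obtain ⟨a, n', hn', hn⟩ := Nat.exists_eq_pow_mul_and_not_dvd hord.ne' p hp.ne_one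
  refine ⟨a, ?_⟩
  -- `y := (1 + x)^(p^a) - 1` is nilpotent (a multiple of `x`)
  set y : A := (1 + x) ^ (p ^ a) - 1 with hy_def
  have hy : IsNilpotent y := by
    obtain ⟨c, hc⟩ : x ∣ y := by
      have h := sub_dvd_pow_sub_pow (1 + x) 1 (p ^ a)
      rwa [add_sub_cancel_left, one_pow] at h
    rw [hc]
    exact Commute.isNilpotent_mul_right (Commute.all _ _) hx
  -- `(1 + y)^(n') = 1`
  have h1 : (1 + y) ^ n' = 1 := by
    have h1y : 1 + y = (1 + x) ^ (p ^ a) := by rw [hy_def]; ring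
    rw [h1y, ← pow_mul, ← hn, ← hu, ← Units.val_pow_eq_pow_val, pow_orderOf_eq_one, Units.val_one]
  -- `n'` is a unit of `A`
  have hn'u : IsUnit (n' : A) := by
    obtain ⟨N, hN⟩ := hpA
    have hcop : IsCoprime ((p ^ N : ℕ) : ℤ) (n' : ℤ) :=
      Nat.isCoprime_iff_coprime.mpr (Nat.Coprime.pow_left N ((Nat.Prime.coprime_iff_not_dvd hp).mpr hn'))
    have hcopA : IsCoprime ((p : A) ^ N) (n' : A) := by
      simpa using hcop.map (Int.castRingHom A)
    rw [hN] at hcopA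
    exact isCoprime_zero_left.mp hcopA
  -- `y · (n' + y c) = 0` with `n' + y c` a unit, so `y = 0`
  obtain ⟨c, hc⟩ := exists_one_add_pow_eq y n'
  have hyc : y * ((n' : A) + y * c) = 0 := by
    have : (1 + y) ^ n' - 1 = 0 := by rw [h1, sub_self]
    rw [hc] at this
    rw [← this]
    ring
  have hunit : IsUnit ((n' : A) + y * c) :=
    IsNilpotent.isUnit_add_left_of_commute (Commute.isNilpotent_mul_right (Commute.all _ _) hy) hn'u
      (Commute.all _ _)
  have hy0 : y = 0 := (hunit.mul_left_eq_zero).mp hyc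
  have : (1 + x) ^ (p ^ a) - 1 = 0 := hy0
  rwa [sub_eq_zero] at this

end PureAlgebra

/-! ## §2 The finite quotient `A_{m,k} = Λ/(q_m, p^k)`: `T` and `p` are nilpotent there -/

variable (p : ℕ) [hp : Fact p.Prime]

/-- `T^{mk} ∈ (q_m, p^k)`: from `T^m = q_m − p` one gets `T^{mk} ≡ (−p)^k ≡ 0`.
[cite: Howard2004HeegnerKolyvagin, §2.2 and proof of Thm. 2.2.10 (𝔮 = T^m + p)] -/
theorem X_pow_mul_mem_span_qm_sup_span_C_pow (m k : ℕ) :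
    (PowerSeries.X : IwasawaAlgebra p) ^ (m * k) ∈
      Ideal.span {(PowerSeries.X ^ m + PowerSeries.C (p : ℤ_[p]) : IwasawaAlgebra p)} ⊔
        Ideal.span {PowerSeries.C ((p : ℤ_[p]) ^ k)} := by
  set I : Ideal (IwasawaAlgebra p) :=
    Ideal.span {(PowerSeries.X ^ m + PowerSeries.C (p : ℤ_[p]) : IwasawaAlgebra p)} ⊔
      Ideal.span {PowerSeries.C ((p : ℤ_[p]) ^ k)} with hI
  rw [← Ideal.Quotient.eq_zero_iff_mem, map_pow, pow_mul]
  have hq : Ideal.Quotient.mk I (PowerSeries.X ^ m + PowerSeries.C (p : ℤ_[p])) = 0 :=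
    Ideal.Quotient.eq_zero_iff_mem.mpr (Ideal.mem_sup_left (Ideal.mem_span_singleton_self _))
  have hXm : Ideal.Quotient.mk I (PowerSeries.X ^ m) = - Ideal.Quotient.mk I (PowerSeries.C (p : ℤ_[p])) := by
    rw [map_add] at hq
    exact eq_neg_of_add_eq_zero_left hq
  have hpk : Ideal.Quotient.mk I (PowerSeries.C ((p : ℤ_[p]) ^ k)) = 0 :=
    Ideal.Quotient.eq_zero_iff_mem.mpr (Ideal.mem_sup_right (Ideal.mem_span_singleton_self _))
  rw [← map_pow, hXm, neg_pow, ← map_pow, ← map_pow (PowerSeries.C (R := ℤ_[p])), hpk, mul_zero]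

/-- `T` is nilpotent in `A_{m,k} = Λ/(q_m, p^k)`. [cite: Howard2004HeegnerKolyvagin, §2.2 and proof of Thm. 2.2.10 (𝔮 = T^m + p)] -/
theorem isNilpotent_mk_X (m k : ℕ) :
    IsNilpotent (Ideal.Quotient.mk
      (Ideal.span {(PowerSeries.X ^ m + PowerSeries.C (p : ℤ_[p]) : IwasawaAlgebra p)} ⊔
        Ideal.span {PowerSeries.C ((p : ℤ_[p]) ^ k)}) PowerSeries.X) :=
  ⟨m * k, by rw [← map_pow, Ideal.Quotient.eq_zero_iff_mem]; exact X_pow_mul_mem_span_qm_sup_span_C_pow p m k⟩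

/-- `p^k = 0` in `A_{m,k} = Λ/(q_m, p^k)` (so `A_{m,k}` is a `ℤ/p^k`-algebra). [cite: Washington1997, §13.2] -/
theorem natCast_pow_eq_zero_quotient (m k : ℕ) :
    ((p : IwasawaAlgebra p ⧸
      (Ideal.span {(PowerSeries.X ^ m + PowerSeries.C (p : ℤ_[p]) : IwasawaAlgebra p)} ⊔
        Ideal.span {PowerSeries.C ((p : ℤ_[p]) ^ k)})) ^ k) = 0 := by
  have h : ((p : IwasawaAlgebra p) ^ k) = PowerSeries.C ((p : ℤ_[p]) ^ k) := by
    rw [map_pow, map_natCast]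
  rw [← map_natCast (Ideal.Quotient.mk _), ← map_pow, h, Ideal.Quotient.eq_zero_iff_mem]
  exact Ideal.mem_sup_right (Ideal.mem_span_singleton_self _)

/-- `p` is nilpotent in `A_{m,k} = Λ/(q_m, p^k)`. [cite: Washington1997, §13.2] -/
theorem isNilpotent_natCast_quotient (m k : ℕ) :
    IsNilpotent (p : IwasawaAlgebra p ⧸
      (Ideal.span {(PowerSeries.X ^ m + PowerSeries.C (p : ℤ_[p]) : IwasawaAlgebra p)} ⊔
        Ideal.span {PowerSeries.C ((p : ℤ_[p]) ^ k)})) :=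
  ⟨k, natCast_pow_eq_zero_quotient p m k⟩

/-- `A_{m,k} = Λ/(q_m, p^k)` is FINITE (`#A_{m,k} = p^{km}`, tree `card_quotient_span_qm_sup_span_C_pow`), `m ≥ 1`.
[cite: Howard2004HeegnerKolyvagin, proof of Thm. 2.2.10 (𝔮 = T^m + p)] [cite: Washington1997, §13.2 (Prop. 13.8)] -/
theorem finite_quotient_span_qm_sup_span_C_pow {m : ℕ} (hm : 1 ≤ m) (k : ℕ) :
    Finite (IwasawaAlgebra p ⧸
      (Ideal.span {(PowerSeries.X ^ m + PowerSeries.C (p : ℤ_[p]) : IwasawaAlgebra p)} ⊔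
        Ideal.span {PowerSeries.C ((p : ℤ_[p]) ^ k)})) := by
  apply Nat.finite_of_card_ne_zero
  rw [card_quotient_span_qm_sup_span_C_pow p hm k]
  exact pow_ne_zero _ hp.out.ne_zero

/-! ## §3 `ω_n = (1+T)^{p^n} − 1 ∈ (q_m, p^k)` for all large `n` -/

/-- **`(1+T)^{p^J} = 1` in `A_{m,k}` for some `J`**: the unit `1 + T` of the finite ring `Λ/(q_m, p^k)` has
`p`-power order (`T` and `p` are nilpotent there). [cite: Howard2004HeegnerKolyvagin, §2.2 and proof of Thm. 2.2.10 (𝔮 = T^m + p)]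
[cite: Washington1997, §13.2 (Lemma 13.7)] -/
theorem exists_mk_onePlusX_pow_prime_pow_eq_one {m : ℕ} (hm : 1 ≤ m) (k : ℕ) :
    ∃ J : ℕ, (Ideal.Quotient.mk
      (Ideal.span {(PowerSeries.X ^ m + PowerSeries.C (p : ℤ_[p]) : IwasawaAlgebra p)} ⊔
        Ideal.span {PowerSeries.C ((p : ℤ_[p]) ^ k)}) (1 + PowerSeries.X)) ^ (p ^ J) = 1 := by
  haveI := finite_quotient_span_qm_sup_span_C_pow p hm k
  have h := exists_one_add_pow_prime_pow_eq_one hp.out (isNilpotent_natCast_quotient p m k)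
    (isNilpotent_mk_X p m k)
  simpa only [map_add, map_one] using h

/-- **`∃ J, ω_J = (1+T)^{p^J} − 1 ∈ (q_m, p^k)`** (`m ≥ 1`). [cite: Howard2004HeegnerKolyvagin, §2.2 and proof of Thm. 2.2.10 (𝔮 = T^m + p)]
[cite: Washington1997, §13.2 (Lemma 13.7)] -/
theorem exists_onePlusX_pow_prime_pow_sub_one_mem {m : ℕ} (hm : 1 ≤ m) (k : ℕ) :
    ∃ J : ℕ, ((1 + PowerSeries.X : IwasawaAlgebra p) ^ (p ^ J) - 1) ∈
      Ideal.span {(PowerSeries.X ^ m + PowerSeries.C (p : ℤ_[p]) : IwasawaAlgebra p)} ⊔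
        Ideal.span {PowerSeries.C ((p : ℤ_[p]) ^ k)} := by
  obtain ⟨J, hJ⟩ := exists_mk_onePlusX_pow_prime_pow_eq_one p hm k
  refine ⟨J, ?_⟩
  rw [← Ideal.Quotient.eq, map_one,
    RingHom.map_pow (Ideal.Quotient.mk _) (1 + PowerSeries.X : IwasawaAlgebra p) (p ^ J)]
  exact hJ

/-- `ω_J ∣ ω_n` for `J ≤ n`: `(1+T)^{p^n} − 1 = ((1+T)^{p^J})^{p^{n−J}} − 1`. [cite: Washington1997, §13.2 (Lemma 13.7)] -/
theorem onePlusX_pow_prime_pow_sub_one_dvd_of_le {J n : ℕ} (hJn : J ≤ n) :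
    ((1 + PowerSeries.X : IwasawaAlgebra p) ^ (p ^ J) - 1) ∣
      ((1 + PowerSeries.X : IwasawaAlgebra p) ^ (p ^ n) - 1) := by
  have h := sub_dvd_pow_sub_pow ((1 + PowerSeries.X : IwasawaAlgebra p) ^ (p ^ J)) 1 (p ^ (n - J))
  rwa [one_pow, ← pow_mul, ← pow_add, Nat.add_sub_cancel' hJn] at h

/-- **`∃ J, ∀ n ≥ J, ω_n ∈ (q_m, p^k)`** (`m ≥ 1`): for all large `n` the finite Eisenstein quotient `A_{m,k}` is a
quotient of the level-`n` coefficient ring `Λ/(ω_n, p^k)`. [cite: Howard2004HeegnerKolyvagin, Lemma 2.2.7 and Prop. 2.2.8 (control at 𝔮)]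
[cite: Washington1997, §13.2 (Lemma 13.7)] -/
theorem exists_forall_onePlusX_pow_prime_pow_sub_one_mem {m : ℕ} (hm : 1 ≤ m) (k : ℕ) :
    ∃ J : ℕ, ∀ n : ℕ, J ≤ n → ((1 + PowerSeries.X : IwasawaAlgebra p) ^ (p ^ n) - 1) ∈
      Ideal.span {(PowerSeries.X ^ m + PowerSeries.C (p : ℤ_[p]) : IwasawaAlgebra p)} ⊔
        Ideal.span {PowerSeries.C ((p : ℤ_[p]) ^ k)} := by
  obtain ⟨J, hJ⟩ := exists_onePlusX_pow_prime_pow_sub_one_mem p hm k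
  refine ⟨J, fun n hn ↦ ?_⟩
  obtain ⟨c, hc⟩ := onePlusX_pow_prime_pow_sub_one_dvd_of_le p hn
  rw [hc]
  exact Ideal.mul_mem_right _ _ hJ

/-- **`(ω_n, p^k) ≤ (q_m, p^k)` whenever `ω_n ∈ (q_m, p^k)`** — the change of coefficients
`Λ/(ω_n, p^k) ↠ Λ/(q_m, p^k)` from the level-`n` group ring `ℤ/p^k[Gal(K_n/K)] = Λ/(ω_n, p^k)` to `A_{m,k}`
(`Ideal.Quotient.factor` along this inequality). [cite: Howard2004HeegnerKolyvagin, Lemma 2.2.7 and Prop. 2.2.8 (control at 𝔮)]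
[cite: Washington1997, §13.2 (Lemma 13.7)] -/
theorem span_omega_sup_span_C_pow_le {m k n : ℕ}
    (hn : ((1 + PowerSeries.X : IwasawaAlgebra p) ^ (p ^ n) - 1) ∈
      Ideal.span {(PowerSeries.X ^ m + PowerSeries.C (p : ℤ_[p]) : IwasawaAlgebra p)} ⊔
        Ideal.span {PowerSeries.C ((p : ℤ_[p]) ^ k)}) :
    Ideal.span {((1 + PowerSeries.X : IwasawaAlgebra p) ^ (p ^ n) - 1)} ⊔
        Ideal.span {PowerSeries.C ((p : ℤ_[p]) ^ k)} ≤
      Ideal.span {(PowerSeries.X ^ m + PowerSeries.C (p : ℤ_[p]) : IwasawaAlgebra p)} ⊔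
        Ideal.span {PowerSeries.C ((p : ℤ_[p]) ^ k)} :=
  sup_le ((Ideal.span_singleton_le_iff_mem _).mpr hn) le_sup_right

/-- **For all large `n`, `A_{m,k}` is a quotient of `Λ/(ω_n, p^k)`**: `∃ J, ∀ n ≥ J, (ω_n, p^k) ≤ (q_m, p^k)` (`m ≥ 1`).
[cite: Howard2004HeegnerKolyvagin, Lemma 2.2.7 and Prop. 2.2.8 (control at 𝔮)] [cite: Washington1997, §13.2 (Lemma 13.7)] -/
theorem exists_forall_span_omega_sup_span_C_pow_le {m : ℕ} (hm : 1 ≤ m) (k : ℕ) :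
    ∃ J : ℕ, ∀ n : ℕ, J ≤ n →
      Ideal.span {((1 + PowerSeries.X : IwasawaAlgebra p) ^ (p ^ n) - 1)} ⊔
          Ideal.span {PowerSeries.C ((p : ℤ_[p]) ^ k)} ≤
        Ideal.span {(PowerSeries.X ^ m + PowerSeries.C (p : ℤ_[p]) : IwasawaAlgebra p)} ⊔
          Ideal.span {PowerSeries.C ((p : ℤ_[p]) ^ k)} := by
  obtain ⟨J, hJ⟩ := exists_forall_onePlusX_pow_prime_pow_sub_one_mem p hm k
  exact ⟨J, fun n hn ↦ span_omega_sup_span_C_pow_le p (hJ n hn)⟩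

/-- Unit form at all large levels: `∃ J, ∀ n ≥ J, (1+T)^{p^n} = 1` in `A_{m,k}` (the image of `γ^{p^n}` acts
trivially on `E[p^k] ⊗ A_{m,k}(ψ)`). [cite: Howard2004HeegnerKolyvagin, §2.2 and proof of Thm. 2.2.10 (𝔮 = T^m + p)] -/
theorem exists_forall_mk_onePlusX_pow_prime_pow_eq_one {m : ℕ} (hm : 1 ≤ m) (k : ℕ) :
    ∃ J : ℕ, ∀ n : ℕ, J ≤ n → (Ideal.Quotient.mk
      (Ideal.span {(PowerSeries.X ^ m + PowerSeries.C (p : ℤ_[p]) : IwasawaAlgebra p)} ⊔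
        Ideal.span {PowerSeries.C ((p : ℤ_[p]) ^ k)}) (1 + PowerSeries.X)) ^ (p ^ n) = 1 := by
  obtain ⟨J, hJ⟩ := exists_forall_onePlusX_pow_prime_pow_sub_one_mem p hm k
  refine ⟨J, fun n hn ↦ ?_⟩
  have h := hJ n hn
  rw [← Ideal.Quotient.eq, map_one,
    RingHom.map_pow (Ideal.Quotient.mk _) (1 + PowerSeries.X : IwasawaAlgebra p) (p ^ n)] at h
  exact h

end Literature.NumberTheory.EllipticCurves.IwasawaAlgebra

end
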